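import Summits.NavierStokesRegularity.NavierStokesRegularity.Theses.DirectionEnergy
import Summits.NavierStokesRegularity.NavierStokesRegularity.Theorems.DirectionEnergyUntwistedAncientLiouvillePropagate
import Summits.NavierStokesRegularity.NavierStokesRegularity.Theorems.DirectionEnergyUntwistedAncientLiouvilleDirection
import Literature.Analysis.FluidPDE.GigaMiura2011UnidirectionalVorticityHolds
import Literature.Analysis.FluidPDE.KNSSLineInvariantLiouville
import Summits.NavierStokesRegularity.NavierStokesRegularity.Theorems.ClockStretchingLawClockCeilingUnidirectionalVorticityLiouville
import HarnessLib

/-!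
# Route DirectionEnergy, item `UntwistedAncientLiouville` (stmt-NavierStokesRegularity-2893)

**Theorem (KNSS Liouville in the untwisted class, `L_W`).** A bounded ancient mild solution `v`
of Navier–Stokes (`ν = 1`) on `ℝ³ × (−∞, 0)` in the tree's duality form, with measurable slices,
jointly smooth on `(−∞, 0) × ℝ³`, whose vorticity direction `ξ = ω/‖ω‖` has zero derivative
wherever `ω = curl v ≠ 0`, is spatially constant on every slice.

## Proof (Giga–Miura 2011, Prop. 2.2, made symmetric in time by a stabilisation argument, and
## closed by KNSS 2009 Thm 5.1 in the tree's line-invariant form)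

For `t < 0` let `W(t) = {b ∈ ℝ³ | v(t, · + h b) = v(t, ·) ∀ h}` (a subspace).

1. *Every `W(t)` is non-trivial.* By file III (`curl_parallel_of_fderiv_direction_eq_zero`:
   real-analyticity of the slice — Lemarié-Rieusset 2016 Thm. 9.12 transported to the
   duality-form class through the Oseen-mild representative of file I — and the identity
   theorem) either `curl v(t) ≡ 0`, and then `v(t)` is constant (harmonic Liouville,
   `eq_of_curl_eq_zero_of_isDivFree_of_bounded`), so `W(t) = ℝ³`; or `curl v(t) ∥ e(t) ≠ 0`
   everywhere, and then Giga–Miura's slice lemma (`translationInvariant_of_curl_parallel`: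
   `div curl = 0` makes the coefficient constant along `e`, the increment `v(· + he) − v` is
   bounded, irrotational and solenoidal, hence zero) gives `e(t) ∈ W(t)`.
2. *`W` is non-decreasing in `t`* (file II, `translationInvariant_after`: uniqueness of bounded
   Oseen-mild solutions, KNSS 2009 §4, applied to the Oseen-mild representative of file I).
3. *Stabilisation.* A non-decreasing family of subspaces of `ℝ³` is constant on a far-past end
   `t < t₁` (the tree's `exists_end_submodule_const`); with step 2, `W(t₁) ≤ W(t)` for ALL `t < 0`,
   so a non-zero `a ∈ W(t₁)` (step 1) is a direction of invariance of every slice.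
4. *Liouville.* A jointly continuous bounded ancient mild solution invariant along one fixed
   direction is spatially constant on every slice (`apply_eq_apply_zero_of_invariant_along`,
   KNSS 2009 Thm 5.1 through the planar descent, Lemma 2.1 and §4 — all PROVED in the tree).

The measurability hypothesis of the item is implied by the joint smoothness and is not used
otherwise. Nothing here bears on the regularity problem itself: this is a Liouville theorem for
a degenerate (untwisted) class of ancient solutions.

## References

* Y. Giga, H. Miura, Comm. Math. Phys. 303 (2011) 289–300, §2.1, Prop. 2.2. [GigaMiura2011]
* G. Koch, N. Nadirashvili, G. Seregin, V. Šverák, Acta Math. 203 (2009) 83–105 =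
  arXiv:0709.3599: Thm 5.1, Lemma 2.1, §4. [KochNadirashviliSereginSverak2009]
* P. G. Lemarié-Rieusset, *The Navier–Stokes problem in the 21st century*, CRC 2016, Thm. 9.12.
  [LemarieRieusset2016]
-/

set_option linter.dupNamespace false

noncomputable section

open MeasureTheory Set Function Filter Module
open scoped RealInnerProductSpace

namespace Summit.NavierStokesRegularity.NavierStokesRegularity.Theorems

namespace UntwistedAncient

open Literature.Analysis.FluidPDE

/-- **The Liouville theorem in the untwisted class** (module docstring): a bounded ancient mild
solution (`ν = 1`, duality form), jointly smooth on `(−∞, 0) × ℝ³`, whose vorticity direction has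
zero derivative off the zero set of the vorticity on every slice, satisfies `v(t, x) = v(t, 0)`
for all `t < 0`, `x`. [cite: GigaMiura2011, Prop. 2.2; KochNadirashviliSereginSverak2009, Thm 5.1 (arXiv p. 9)] -/
theorem const_of_untwisted
    {v : ℝ → EuclideanSpace ℝ (Fin 3) → EuclideanSpace ℝ (Fin 3)}
    (hv : IsBoundedAncientMildSolution 1 v)
    (hsm : ContDiffOn ℝ (⊤ : ℕ∞) (uncurry v) (Iio 0 ×ˢ univ))
    (hdir : ∀ t < 0, ∀ y, curl (v t) y ≠ 0 → fderiv ℝ (vorticityDirection (curl (v t))) y = 0) :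
    ∀ t < 0, ∀ x, v t x = v t 0 := by
  -- regularity bookkeeping
  have hslice : ∀ t < 0, ContDiff ℝ (⊤ : ℕ∞) (v t) := fun t ht =>
    hsm.comp_contDiff (contDiff_prodMk_right t) fun x => mk_mem_prod (mem_Iio.2 ht) (mem_univ x)
  have hC2 : ∀ t < 0, ContDiff ℝ 2 (v t) := fun t ht => contDiff_infty.1 (hslice t ht) 2
  have hC1 : ∀ t < 0, ContDiff ℝ 1 (v t) := fun t ht => contDiff_infty.1 (hslice t ht) 1
  have hcont : ContinuousOn (uncurry v) (Iio 0 ×ˢ univ) := hsm.continuousOn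
  obtain ⟨K, hK⟩ : ∃ K : ℝ, ∀ t < 0, ∀ x, ‖v t x‖ ≤ K := by
    obtain ⟨C, hC⟩ := hv.2
    exact ⟨C, fun t ht x => hC t ht x⟩
  have hdivF : ∀ t < 0, VectorCalculus.IsDivFree (v t) := fun t ht =>
    (hv.1.1 t ht).isDivFree_of_contDiff (hC1 t ht)
  -- curl-free slices are constant (harmonic Liouville)
  have hconst_of_curl : ∀ t < 0, (∀ x, curl (v t) x = 0) → ∀ x y, v t x = v t y :=
    fun t ht hc x y => eq_of_curl_eq_zero_of_isDivFree_of_bounded (hC2 t ht) hc (hdivF t ht)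
      (hK t ht) x y
  -- the invariance subspaces `W t = {b | v t (· + h b) = v t}`
  let W : ℝ → Submodule ℝ (EuclideanSpace ℝ (Fin 3)) := fun t =>
    { carrier := {b | ∀ (h : ℝ) (x : EuclideanSpace ℝ (Fin 3)), v t (x + h • b) = v t x}
      add_mem' := fun {a b} ha hb h x => by
        rw [smul_add, ← add_assoc, hb h (x + h • a), ha h x]
      zero_mem' := fun h x => by rw [smul_zero, add_zero]
      smul_mem' := fun c b hb h x => by rw [smul_smul]; exact hb (h * c) x }
  have hmemW : ∀ (t : ℝ) (b : EuclideanSpace ℝ (Fin 3)),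
      b ∈ W t ↔ ∀ (h : ℝ) (x : EuclideanSpace ℝ (Fin 3)), v t (x + h • b) = v t x :=
    fun _ _ => Iff.rfl
  -- Step 2: nested forward in time
  have hmono : ∀ s t : ℝ, s < t → t < 0 → W s ≤ W t := by
    intro s t hst ht b hb
    rw [hmemW] at hb ⊢
    intro h x
    exact translationInvariant_after hv hcont (fun y => hb h y) hst ht x
  -- Step 1: every `W t` contains a non-zero vector
  have hne : ∀ t < 0, ∃ b ∈ W t, b ≠ 0 := by
    intro t ht
    rcases curl_parallel_of_fderiv_direction_eq_zero hv hcont ht (hdir t ht) with hc | ⟨e, he, hpar⟩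
    · refine ⟨EuclideanSpace.single 0 1, (hmemW _ _).2 fun h x => hconst_of_curl t ht hc _ _, ?_⟩
      intro h0
      have := congrArg (fun z : EuclideanSpace ℝ (Fin 3) => z 0) h0
      simp at this
    · exact ⟨e, (hmemW _ _).2 fun h x => translationInvariant_of_curl_parallel (hC2 t ht)
        (hdivF t ht) ⟨K, hK t ht⟩ he hpar x h, he⟩
  -- Step 3: far-past stabilisation, one fixed direction of invariance for all `t < 0`
  obtain ⟨t₁, ht₁, hstab⟩ := exists_end_submodule_const W hmono
  have hWend : ∀ t < 0, W t₁ ≤ W t := by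
    intro t ht
    rcases lt_trichotomy t t₁ with h | h | h
    · rw [hstab t h]
    · rw [h]
    · exact hmono t₁ t h ht
  obtain ⟨a, haW, ha⟩ := hne t₁ ht₁
  have hainv : ∀ t < 0, ∀ (x : EuclideanSpace ℝ (Fin 3)) (δ : ℝ), v t (x + δ • a) = v t x :=
    fun t ht x δ => (hmemW t a).1 (hWend t ht haW) δ x
  -- Step 4: the Liouville theorem for invariance along a fixed direction
  exact apply_eq_apply_zero_of_invariant_along ha hv hcont hainv

end UntwistedAncient

/-- **`UntwistedAncientLiouville` holds** (item stmt-NavierStokesRegularity-2893 of route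
DirectionEnergy): every slice of an untwisted, jointly smooth, bounded ancient mild solution
(duality form, `ν = 1`) is a constant vector field (`UntwistedAncient.const_of_untwisted`; the
measurable-slices hypothesis is implied by smoothness and unused). [cite: GigaMiura2011, Prop. 2.2; KochNadirashviliSereginSverak2009, Thm 5.1 (arXiv p. 9)] -/
theorem directionEnergy_untwistedAncientLiouville_proof :
    Summit.NavierStokesRegularity.NavierStokesRegularity.Theses.DirectionEnergy.UntwistedAncientLiouville := by
  unfold Summit.NavierStokesRegularity.NavierStokesRegularity.Theses.DirectionEnergy.UntwistedAncientLiouville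
  intro v hv _hmeas hsm hdir t ht
  exact ⟨v t 0, fun y => UntwistedAncient.const_of_untwisted hv hsm hdir t ht y⟩

end Summit.NavierStokesRegularity.NavierStokesRegularity.Theorems

end
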